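import Literature.AnabelianGeometry.SemiGraphs.NestedRestriction
import Literature.AnabelianGeometry.SemiGraphs.CuspOmission
import Literature.AnabelianGeometry.SemiGraphs.Commensurability

/-!
# [SemiAnbd] Cor. 2.7 (i) for semi-graphs of anabelioids WITH cusps: the sub-semi-graph clause across cusp omission ([IUTchI] §2 p. 44) — PROOFS

Mochizuki, *Inter-universal Teichmüller theory I*, §2 p. 44 l. 24–30 and Prop. 2.2 p. 46: for a
connected sub-semi-graph `ℍ ⊆ 𝔾`, "the restriction of `ℋ` to the maximal subgraph of `ℍ` coincides
with the restriction to the maximal subgraph of … some semi-graph of anabelioids of pro-`Σ`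
PSC-type … the omission of cuspidal edges clearly does not affect … the pro-`Σ̂` fundamental
groups", after which "`C_{Π̂_𝔾}(Π̂_ℍ) = Π̂_ℍ`" is read off "the evident pro-`Σ̂` analogue of [SemiAnbd],
Corollary 2.7, (i)" [cite: Mochizuki2012, §2 p.44]; Mochizuki, *Semi-graphs of anabelioids*,
Cor. 2.7 (i) p. 30 (`corollary_2_7_i`, which binds GRAPHS of anabelioids and sub-GRAPHS)
[cite: MochizukiSemiAnbd2006, Cor. 2.7(i) p.30].

Proof-only companion of `CuspOmission.lean` (abc-iut-L3-t1 g2: `B(𝒢) ⥤ B(𝒢_ℍ)` is an equivalence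
for a cusp omission, `Π_ℍ ⥲ Π_𝒢`, the VERTEX clause) and `NestedRestriction.lean` (two-level
bookkeeping), supplying the SUB-SEMI-GRAPH clause (abc-iut row W4-30 / L5 residue r2, consumer
[IUTchI] Prop. 2.2 `hHatH`, GAP row G-w5d028-1):

* `isCommensurablyTerminal_map_iff_of_bijective` — commensurable terminality is transported along
  isomorphisms of groups;
* `range_piHToPi_closedPart_eq` — dropping the cusps of a connected sub-semi-graph `K` (passing to
  `K.closedPart`, "the maximal subgraph of `ℍ`") does not change the image `Π_K ⊆ Π_𝒢`;
* `isCommensurablyTerminal_range_piHToPi_iff` — for a cusp omission `H` of `𝔾` (e.g. the maximal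
  subgraph) and a connected `K ⊆ 𝔾` with a vertex: `Π_K` is commensurably terminal in `Π_𝒢` iff
  `Π_{K♭ ∩ H}` is commensurably terminal in `Π_{𝒢_H}` (`K♭ = K.closedPart`);
* `isConnected_closedPart_restrictTo`, `isGraph_closedPart_restrictTo` — the hypotheses Cor. 2.7 (i)
  asks of the sub-semi-graph hold for `K♭ ∩ H ⊆ H`;
* `isCommensurablyTerminal_range_piHToPi_of_corollary_2_7_i` — **consumer form**: from the named
  fact `corollary_2_7_i` (F-1458) applied to the cusp-omitted graph `𝒢_{𝔾_max}`, for `𝒢` connected,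
  `K ⊆ 𝔾` connected with a vertex, `𝒢_{𝔾_max}` quasi-coherent and the vertices of `K` elevated in
  `𝒢_{𝔾_max}` (the consumer's remaining atoms, stated on the cusp-omitted graph), `Π_K ⊆ Π_𝒢` is
  commensurably terminal — for `𝒢` WITH cusps.

Nothing here takes a side on [IUTchIII] Cor. 3.12; `corollary_2_7_i` enters BY NAME as a hypothesis.
-/

namespace Literature.AnabelianGeometry.SemiGraphs

open CategoryTheory CategoryTheory.PreGaloisCategory
open Literature.AnabelianGeometry.Anabelioids

universe w v₁ u₁ u

/-! ### Commensurable terminality along group isomorphisms -/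

/-- Commensurable terminality is invariant under bijective homomorphisms:
`C_{G'}(f K) = f K ↔ C_G(K) = K` ([SemiAnbd] §0 p. 5 vocabulary).
[cite: MochizukiSemiAnbd2006, §0 p.5] -/
theorem isCommensurablyTerminal_map_iff_of_bijective {G G' : Type*} [Group G] [Group G']
    (f : G →* G') (hf : Function.Bijective f) (K : Subgroup G) :
    AbsoluteAnabelian.IsCommensurablyTerminal (K.map f) ↔
      AbsoluteAnabelian.IsCommensurablyTerminal K := by
  rw [AbsoluteAnabelian.isCommensurablyTerminal_iff, AbsoluteAnabelian.isCommensurablyTerminal_iff,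
    SemiGraphOfAnabelioids.commensurator_map_of_bijective f hf K]
  exact (Subgroup.map_injective hf.1).eq_iff

namespace SemiGraph

variable {G : SemiGraph.{u}}

/-! ### The closed part of a sub-semi-graph under a cusp omission -/

/-- A cusp omission omits no CLOSED edge. [cite: MochizukiSemiAnbd2006, §1 p.13] -/
theorem Subgraph.IsCuspOmission.mem_edges_of_isClosedEdge {H : G.Subgraph} (hH : H.IsCuspOmission)
    {e : G.Edge} (he : G.IsClosedEdge e) : e ∈ H.edges := by
  by_contra hne
  obtain ⟨b, -, -, huniq⟩ := hH.existsUnique_abuts e hne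
  have hsub : G.verticialPortion e ⊆ {b} := fun x hx => huniq x hx.1 hx.2
  have hle : G.vertCard e ≤ 1 := by
    change (G.verticialPortion e).ncard ≤ 1
    calc (G.verticialPortion e).ncard ≤ ({b} : Set G.Branch).ncard :=
          Set.ncard_le_ncard hsub (Set.toFinite _)
      _ = 1 := Set.ncard_singleton b
  have h2 : G.vertCard e = 2 := he
  omega

/-- An edge of a sub-semi-graph `K` which is closed IN `K` is closed in `G` (both of its branches abut,
to vertices of `K`). [cite: MochizukiSemiAnbd2006, §1 p.12] -/
theorem Subgraph.isClosedEdge_of_isClosedEdge_toSemiGraph (K : G.Subgraph) {e : G.Edge}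
    (he : e ∈ K.edges) (hc : K.toSemiGraph.IsClosedEdge ⟨e, he⟩) : G.IsClosedEdge e := by
  obtain ⟨c₁, c₂, hne, h₁, h₂, -⟩ := K.toSemiGraph.two_branches ⟨e, he⟩
  have hs₁ := K.toSemiGraph.isSome_abuts_of_mem_maximalSubgraph (b := c₁) (by rw [h₁]; exact hc)
  have hs₂ := K.toSemiGraph.isSome_abuts_of_mem_maximalSubgraph (b := c₂) (by rw [h₂]; exact hc)
  obtain ⟨v₁, hv₁⟩ := Option.isSome_iff_exists.mp hs₁
  obtain ⟨v₂, hv₂⟩ := Option.isSome_iff_exists.mp hs₂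
  have hG₁ : G.abuts c₁.1 = some v₁.1 := (K.abuts_eq_some_iff c₁ v₁).mp hv₁
  have hG₂ : G.abuts c₂.1 = some v₂.1 := (K.abuts_eq_some_iff c₂ v₂).mp hv₂
  have hsub : ({c₁.1, c₂.1} : Set G.Branch) ⊆ G.verticialPortion e := by
    rintro x (rfl | rfl)
    · exact ⟨congrArg Subtype.val h₁, by rw [hG₁]; rfl⟩
    · exact ⟨congrArg Subtype.val h₂, by rw [hG₂]; rfl⟩
  have hne' : c₁.1 ≠ c₂.1 := fun h => hne (Subtype.ext h)
  apply le_antisymm (G.vertCard_le_two e)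
  change 2 ≤ (G.verticialPortion e).ncard
  calc 2 = ({c₁.1, c₂.1} : Set G.Branch).ncard := (Set.ncard_pair hne').symm
    _ ≤ (G.verticialPortion e).ncard := Set.ncard_le_ncard hsub (by
        obtain ⟨b₁, b₂, -, -, -, hall⟩ := G.two_branches e
        exact (Set.toFinite ({b₁, b₂} : Set G.Branch)).subset fun x hx => by
          rcases hall x hx.1 with rfl | rfl <;> simp)

/-- The edges of the closed part of `K` are closed in `G`, hence kept by any cusp omission.
[cite: MochizukiSemiAnbd2006, §1 p.13] -/
theorem Subgraph.closedPart_edges_subset_of_isCuspOmission (K : G.Subgraph) {H : G.Subgraph}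
    (hH : H.IsCuspOmission) : K.closedPart.edges ⊆ H.edges :=
  fun _ ⟨he, hc⟩ => hH.mem_edges_of_isClosedEdge (K.isClosedEdge_of_isClosedEdge_toSemiGraph he hc)

/-- Inside a connected sub-semi-graph `K` with a vertex, its closed part is a cusp omission
(it is the maximal subgraph of `K`). [cite: MochizukiSemiAnbd2006, §1 p.13] -/
theorem Subgraph.isCuspOmission_closedPart_restrictTo_self (K : G.Subgraph)
    (hK : K.toSemiGraph.IsConnected) (w : K.toSemiGraph.Vertex) :
    (K.closedPart.restrictTo K).IsCuspOmission := by
  rw [K.closedPart_restrictTo_self]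
  exact maximalSubgraph_isCuspOmission_of_isConnected hK ⟨w⟩

/-- A morphism of semi-graphs that is surjective on vertices, edges and branches carries
connectedness (its node map is a surjective homomorphism of barycentric subdivisions).
[cite: MochizukiSemiAnbd2006, §1 pp.11-13] -/
theorem IsConnected.of_hom_surjective {G₁ G₂ : SemiGraph.{u}} (φ : G₁ ⟶ G₂)
    (hV : Function.Surjective φ.vertexMap) (hE : Function.Surjective φ.edgeMap)
    (hB : Function.Surjective φ.branchMap) (h : G₁.IsConnected) : G₂.IsConnected :=
  ⟨h.connected.map
    ⟨Sum.map φ.vertexMap (Sum.map φ.edgeMap φ.branchMap), fun hxy => subdivision_adj_map φ hxy⟩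
    (Sum.map_surjective.mpr ⟨hV, Sum.map_surjective.mpr ⟨hE, hB⟩⟩)⟩

/-- **Connectedness of `K♭ ∩ H ⊆ H`**: for a cusp omission `H` and a connected sub-semi-graph `K`
with a vertex, the sub-semi-graph `K♭ ∩ H` of `H` (`K♭ = K.closedPart`) is connected — it is the
maximal subgraph of `K`, re-indexed. [cite: MochizukiSemiAnbd2006, §1 p.13] -/
theorem Subgraph.isConnected_closedPart_restrictTo (K : G.Subgraph) {H : G.Subgraph}
    (hH : H.IsCuspOmission) (hK : K.toSemiGraph.IsConnected) (w : K.toSemiGraph.Vertex) :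
    (K.closedPart.restrictTo H).toSemiGraph.IsConnected := by
  have hE : K.closedPart.edges ⊆ H.edges := K.closedPart_edges_subset_of_isCuspOmission hH
  have h0 : (K.closedPart.restrictTo K).toSemiGraph.IsConnected :=
    (K.isCuspOmission_closedPart_restrictTo_self hK w).isConnected hK
  -- the re-indexing morphism `(K♭ ∩ K ⊆ K) → (K♭ ∩ H ⊆ H)`
  let ψ : (K.closedPart.restrictTo K).toSemiGraph ⟶ (K.closedPart.restrictTo H).toSemiGraph :=
    { vertexMap := fun v => ⟨hH.vtx v.1.1, v.2⟩
      edgeMap := fun e => ⟨⟨e.1.1, hE e.2⟩, e.2⟩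
      branchMap := fun b => ⟨⟨b.1.1, hE b.2⟩, b.2⟩
      edgeOf_branchMap := fun _ => rfl
      branchMap_injOn := fun b₁ b₂ _ hb =>
        Subtype.ext (Subtype.ext (congrArg (fun x => x.1.1) hb))
      abuts_branchMap := fun b v hbv => by
        have h1 : G.abuts b.1.1 = some v.1.1 :=
          (K.abuts_eq_some_iff _ _).mp (((K.closedPart.restrictTo K).abuts_eq_some_iff b v).mp hbv)
        exact ((K.closedPart.restrictTo H).abuts_eq_some_iff _ _).mpr
          ((H.abuts_eq_some_iff _ _).mpr h1) }
  refine IsConnected.of_hom_surjective ψ ?_ ?_ ?_ h0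
  · rintro ⟨⟨u, hu⟩, hu'⟩
    exact ⟨⟨⟨u, hu'⟩, hu'⟩, rfl⟩
  · rintro ⟨⟨e, he⟩, he'⟩
    exact ⟨⟨⟨e, K.closedPart_edges_subset he'⟩, he'⟩, rfl⟩
  · rintro ⟨⟨b, hb⟩, hb'⟩
    exact ⟨⟨⟨b, K.closedPart_edges_subset hb'⟩, hb'⟩, rfl⟩

/-- **`K♭ ∩ H ⊆ H` is a graph**: every branch of an edge of `K` closed in `K` abuts, to a vertex of
`K` (kept by the cusp omission `H`). [cite: MochizukiSemiAnbd2006, §1 p.13] -/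
theorem Subgraph.isGraph_closedPart_restrictTo (K : G.Subgraph) {H : G.Subgraph}
    (hH : H.IsCuspOmission) : (K.closedPart.restrictTo H).toSemiGraph.IsGraph := by
  refine ⟨fun b => ?_⟩
  obtain ⟨he, hc⟩ := (b.2 : G.edgeOf b.1.1 ∈ K.closedPart.edges)
  have hs := K.toSemiGraph.isSome_abuts_of_mem_maximalSubgraph (b := ⟨b.1.1, he⟩) hc
  obtain ⟨v, hv⟩ := Option.isSome_iff_exists.mp hs
  have hG : G.abuts b.1.1 = some v.1 := (K.abuts_eq_some_iff _ v).mp hv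
  have : (K.closedPart.restrictTo H).toSemiGraph.abuts b = some ⟨hH.vtx v.1, v.2⟩ :=
    ((K.closedPart.restrictTo H).abuts_eq_some_iff _ _).mpr ((H.abuts_eq_some_iff _ _).mpr hG)
  rw [this]
  rfl

end SemiGraph

namespace SemiGraphOfAnabelioids

variable {𝒢 : SemiGraphOfAnabelioids.{v₁, u₁, u}} {H : 𝒢.graph.Subgraph}

/-! ### Dropping the cusps of `K` does not change `Π_K ⊆ Π_𝒢` -/

/-- **Passing to the closed part of a connected sub-semi-graph `K` (with a vertex) does not change
the image `Π_K ⊆ Π_𝒢`** ([IUTchI] p. 44: "the restriction of `ℋ` to the maximal subgraph of `ℍ` …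
the omission of cuspidal edges clearly does not affect … the fundamental groups").
[cite: Mochizuki2012, §2 p.44] -/
theorem range_piHToPi_closedPart_eq (K : 𝒢.graph.Subgraph) (hK : K.toSemiGraph.IsConnected)
    (w : K.toSemiGraph.Vertex) (F : 𝒢.V w.1 ⥤ FintypeCat.{w}) :
    (𝒢.piHToPi K.closedPart ⟨w.1, w.2⟩ F).range = (𝒢.piHToPi K w F).range := by
  rw [range_piHToPi_eq_map_range (K := K.closedPart) (H := K) (fun _ h => h)
    K.closedPart_edges_subset ⟨w.1, w.2⟩ F,
    MonoidHom.range_eq_top.mpr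
      (piHToPi_bijective (𝒢 := 𝒢.restrict K) (K.isCuspOmission_closedPart_restrictTo_self hK w)
        ⟨⟨w.1, w.2⟩, w.2⟩ F).2,
    ← MonoidHom.range_eq_map]
  rfl

/-! ### The sub-semi-graph clause of Cor. 2.7 (i) across a cusp omission -/

/-- **`Π_K` is commensurably terminal in `Π_𝒢` iff `Π_{K♭ ∩ H}` is commensurably terminal in
`Π_{𝒢_H}`**, for a cusp omission `H ⊆ 𝔾` and a connected sub-semi-graph `K ⊆ 𝔾` with a vertex `w`
(`K♭ = K.closedPart`; basepoints through `w`): the images `Π_K` and `Π_{K♭}` in `Π_𝒢` agree, the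
latter is the image of `Π_{K♭ ∩ H} ⊆ Π_{𝒢_H}` under the ISOMORPHISM `Π_{𝒢_H} ⥲ Π_𝒢`, and
commensurators are transported along isomorphisms. [cite: Mochizuki2012, §2 p.44] -/
theorem isCommensurablyTerminal_range_piHToPi_iff (hH : H.IsCuspOmission) (K : 𝒢.graph.Subgraph)
    (hK : K.toSemiGraph.IsConnected) (w : K.toSemiGraph.Vertex) (F : 𝒢.V w.1 ⥤ FintypeCat.{w}) :
    AbsoluteAnabelian.IsCommensurablyTerminal (𝒢.piHToPi K w F).range ↔
      AbsoluteAnabelian.IsCommensurablyTerminal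
        ((𝒢.restrict H).piHToPi (K.closedPart.restrictTo H) ⟨hH.vtx w.1, w.2⟩ F).range := by
  rw [← range_piHToPi_closedPart_eq K hK w F,
    range_piHToPi_eq_map_range (K := K.closedPart) (H := H) (fun v _ => (hH.vtx v).2)
      (K.closedPart_edges_subset_of_isCuspOmission hH) ⟨w.1, w.2⟩ F]
  exact isCommensurablyTerminal_map_iff_of_bijective _ (piHToPi_bijective hH (hH.vtx w.1) F) _

/-- **[SemiAnbd] Cor. 2.7 (i), sub-semi-graph clause, for semi-graphs of anabelioids WITH cusps**
(consumer form of [IUTchI] §2 p. 44 / Prop. 2.2 `hHatH`): assume the named fact `corollary_2_7_i`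
(F-1458).  Let `𝒢` be connected, `K ⊆ 𝔾` a connected sub-semi-graph with a vertex `w`, and suppose
that AFTER OMITTING THE CUSPS — on the graph of anabelioids `𝒢_{𝔾_max}` — `𝒢_{𝔾_max}` is
quasi-coherent and the vertices of `K` are elevated.  Then `Π_K ⊆ Π_𝒢` is commensurably terminal
(basepoint through `w`). [cite: Mochizuki2012, §2 p.44] -/
theorem isCommensurablyTerminal_range_piHToPi_of_corollary_2_7_i
    (h27 : corollary_2_7_i.{v₁, u₁, u}) (h𝒢 : 𝒢.IsConnected)
    (hq : (𝒢.restrict 𝒢.graph.maximalSubgraph).IsQuasiCoherent)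
    (K : 𝒢.graph.Subgraph) (hK : K.toSemiGraph.IsConnected) (w : K.toSemiGraph.Vertex)
    (hel : ∀ v : K.toSemiGraph.Vertex,
      (𝒢.restrict 𝒢.graph.maximalSubgraph).IsElevated ⟨v.1, trivial⟩)
    (F : 𝒢.V w.1 ⥤ FintypeCat.{v₁}) [FiberFunctor F] :
    AbsoluteAnabelian.IsCommensurablyTerminal (𝒢.piHToPi K w F).range := by
  have hH : 𝒢.graph.maximalSubgraph.IsCuspOmission :=
    𝒢.graph.maximalSubgraph_isCuspOmission_of_isConnected h𝒢.isConnected ⟨w.1⟩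
  rw [isCommensurablyTerminal_range_piHToPi_iff hH K hK w F]
  have h := (h27 (𝒢.restrict 𝒢.graph.maximalSubgraph)
    (isConnected_restrict_maximalSubgraph 𝒢 h𝒢 ⟨w.1⟩)
    (isGraphOfAnabelioids_restrict_maximalSubgraph 𝒢) hq).1
    (K.closedPart.restrictTo 𝒢.graph.maximalSubgraph)
    (K.isConnected_closedPart_restrictTo hH hK w) (K.isGraph_closedPart_restrictTo hH)
    (fun v => hel ⟨v.1.1, v.2⟩) ⟨hH.vtx w.1, w.2⟩
  -- the basepoint `F` of `𝒢_w = (𝒢_{𝔾_max})_w` (same constituent anabelioid, definitionally)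
  exact @h F (by assumption)

/-! ### The vertex clause of Cor. 2.7 (i) for semi-graphs of anabelioids with cusps -/

/-- **[SemiAnbd] Cor. 2.7 (i), vertex clause ("in particular, if `v` is an elevated vertex of `𝒢`,
then `C_{Π_𝒢}(Π_v) = Π_v`"), for semi-graphs of anabelioids WITH cusps**: assume the named fact
`corollary_2_7_i` (F-1458).  Let `𝒢` be connected and suppose that after omitting the cusps the
graph of anabelioids `𝒢_{𝔾_max}` is quasi-coherent and `v` is elevated in it.  Then `Π_v ⊆ Π_𝒢` is
commensurably terminal (every basepoint of `𝒢_v`) — clause 2 of F-1458 at `𝒢_{𝔾_max}` read back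
on `𝒢` through `Π_{𝒢_{𝔾_max}} ⥲ Π_𝒢` (`isCommensurablyTerminal_range_piVToPi_iff`, abc-iut-L3-t1
gen 2). [cite: Mochizuki2012, §2 p.44] -/
theorem isCommensurablyTerminal_range_piVToPi_of_corollary_2_7_i
    (h27 : corollary_2_7_i.{v₁, u₁, u}) (h𝒢 : 𝒢.IsConnected)
    (hq : (𝒢.restrict 𝒢.graph.maximalSubgraph).IsQuasiCoherent) (v : 𝒢.graph.Vertex)
    (hel : (𝒢.restrict 𝒢.graph.maximalSubgraph).IsElevated ⟨v, trivial⟩)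
    (F : 𝒢.V v ⥤ FintypeCat.{v₁}) [FiberFunctor F] :
    AbsoluteAnabelian.IsCommensurablyTerminal (𝒢.piVToPi v F).range := by
  have hH : 𝒢.graph.maximalSubgraph.IsCuspOmission :=
    𝒢.graph.maximalSubgraph_isCuspOmission_of_isConnected h𝒢.isConnected ⟨v⟩
  rw [← isCommensurablyTerminal_range_piVToPi_iff hH ⟨v, trivial⟩ F]
  have h := (h27 (𝒢.restrict 𝒢.graph.maximalSubgraph)
    (isConnected_restrict_maximalSubgraph 𝒢 h𝒢 ⟨v⟩)
    (isGraphOfAnabelioids_restrict_maximalSubgraph 𝒢) hq).2 ⟨v, trivial⟩ hel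
  exact @h F (by assumption)

end SemiGraphOfAnabelioids

end Literature.AnabelianGeometry.SemiGraphs
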